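import Summits.QuantumFields.YangMills.Theorems.BalabanUVNodesK0RecordFormatNamesFluctEk
import Summits.QuantumFields.YangMills.Theorems.BalabanUVNodesPortS1SmallSu2
import Summits.QuantumFields.YangMills.Theorems.BalabanUVNodesPortS1ChartJacobianRecord
import Summits.QuantumFields.YangMills.Theorems.BalabanUVNodesN07DirectMethod
import HarnessLib

/-!
# `𝐄_k` READ IN THE CHART IS CONTINUOUS ∕ MEASURABLE ∕ INTEGRABLE ON THE FLAT WINDOW, GIVEN THE DISPLAYED N09-CLASS CONTINUITY OF `A_k` AND OF `A^η ∘ U_k`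
# (brick row (o4-d) of ▶ PT-A's `EK-CHART-BRICKS-v1.md` b0872ae801a4fced; ★★★ director-ym №591 (2) docket of porter lineage `ymgap-nodeO-port-PTB-1`, gen 9)

Cell `pub-ymgap` ∕ `ym-nodeO-ideate` ∕ `ym-balaban-port`, porter PT-B (gen 9).  `--kind proof --supports stmt-QuantumFields-27930 --as helper`; count-neutral.
[I] = [Balaban1987RG1].

THE PRINT.  (2.10)∕(2.12)–(2.13) p.268: the fluctuation integral `∫ dB′ σ(B′) χ(…) exp{… + 𝐄_k(U_k(exp(iB′)V^{(k)})) − 𝐄_k(U_k(V^{(k)}))}` over the window of (2.4)∕(2.9) — to be a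
Bochner∕Lebesgue integral of record (DEF-1's stage-2 carrier `recordFluctInt`, NOT yet in the tree) its integrand must be (a.e.-strongly) measurable on the window; print treats `A_k`,
`U_k` as analytic there (p.267 «analytic function», [15] Prop. 9).

WHAT THIS FILE PROVES (0 def; glue — `ContinuousOn.comp`, `ContinuousOn.aestronglyMeasurable`, `ContinuousOn.integrableOn_compact`):
§1 generic transport∕cut-offs (the Wilson action's continuity is REUSED: dag-n07's ✓`N07DirectMethod.continuous_wilsonAction4`): ★ `continuousOn_EkT_of` (`𝐄_k = A_k + (1∕g_k²)·A^η∘U_k` is continuous on `D` if `A_k` and `A^η ∘ U_k` are), `continuousOn_EkT_of_Uk` (the same from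
   `ContinuousOn (Uk …) D`), `measurable_EkT_of`.
§2 at the record's chart (DEF-1 ✓p827012 `recordEkChart`∕`recordEkBracket`, chart ✓`pert` continuous∕measurable by ✓`continuous_pert`∕✓`measurable_pert`): ★★ `continuousOn_recordEkChart_of`,
   `continuousOn_recordEkBracket_of` (on any `S` the chart maps into `D`), `measurable_recordEkChart_of`, ★★ `aestronglyMeasurable_recordEkChart_of`∕`…Bracket…` (on a measurable window,
   for any measure), ★★ `integrableOn_recordEkBracket_of_isCompact` (on a compact window, for any finite-on-compacts measure — the Bochner-integrability the carrier needs).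
HONEST FRAMING.  Glue only.  The continuity of `A_k = effActionHT …` and of `A^η ∘ U_k` (equivalently of the minimiser `U_k` on the regularity class) on a domain `D` containing the
charted window are DISPLAYED hypotheses — dag-n09-w1's ROAD-B class (`continuousOn_gfOfRecord_domAlt`, the `hcrit`-continuity of the selected minimiser); NOTHING of Bałaban is asserted,
ported or discharged; (o4-c)∕(o4-e) NOT here; `recordFluctInt` NOT in the tree; `stub_P0C`∕`stub_FE` OPEN, ⟨stmt-QuantumFields-27930⟩ OPEN (1∕3); K0ᴬ∕K1ᴬ∕K3ᴬ 0∕3; NODE O 0∕1; COUNT 8∕28 ·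
K 1∕4 UNMOVED; finite `𝕋⁴_{L^K}` at fixed ε — NOT continuum ∕ ℝ⁴ ∕ OS; **the Yang–Mills mass gap (Clay) is NOT proved by any of this.**  No `sorry`, `instance`, `notation`, `set_option`;
standard axioms.
-/

noncomputable section

open scoped BigOperators
open MeasureTheory Set

namespace Summit.QuantumFields.YangMills.Theorems.BalabanUVNodesPortS1

open Summit.QuantumFields.YangMills.Theorems.K0RecordFormatNames
open Literature.MathematicalPhysics.QuantumFieldTheory.Balaban1983to89
open Literature.MathematicalPhysics.QuantumFieldTheory.Balaban1983to89.Node00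
open Literature.MathematicalPhysics.QuantumFieldTheory.Balaban1983to89.T4Continuum (T4Family)
open Literature.MathematicalPhysics.QuantumFieldTheory.Balaban1983to89.T4FlagMemory (extd)
open Summit.QuantumFields.YangMills.BalabanUVNodes.N07DirectMethod (continuous_wilsonAction4)

/-! ## §1  Generic transport: `𝐄_k` is continuous ∕ measurable where `A_k` and `A^η ∘ U_k` are -/

section Generic

variable (F : T4Family) (N : ℕ) [NeZero N]

/-- ★ **`𝐄_k = A_k + (1∕g_k²)·A^η ∘ U_k` IS CONTINUOUS ON `D` IF `A_k` AND `A^η ∘ U_k` ARE** (both DISPLAYED: dag-n09-w1's ROAD-B class). Generic transport `T`, cut-offs `χ`, radius `ε`, couplings `g`.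
[cite: Balaban1987RG1, (0.22) p.256, (2.12) p.268] -/
theorem continuousOn_EkT_of (T : Transport F N) (χ : (K : ℕ) → (ℕ → ℝ) → (k : ℕ) → Density (F.P K) k (SU N)) (ε : ℝ) (K : ℕ) (g : ℕ → ℝ) (k : ℕ)
    {D : Set (GaugeField (F.P K) k (SU N))} (hA : ContinuousOn (effActionHT F N T χ K g k) D) (hW : ContinuousOn (fun V => wilsonAction4 (Uk F N K k ε V)) D) :
    ContinuousOn (ZeroInput.EkT F N T χ ε K g k) D := by
  have h : ZeroInput.EkT F N T χ ε K g k = fun V => effActionHT F N T χ K g k V + (1 / (g k) ^ 2) * wilsonAction4 (Uk F N K k ε V) := rfl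
  rw [h]
  exact hA.add (continuousOn_const.mul hW)

/-- The same from the continuity of the minimiser `U_k` itself on `D` (`A^η` is continuous everywhere, dag-n07's ✓`N07DirectMethod.continuous_wilsonAction4`). [cite: Balaban1987RG1, (0.22) p.256, (0.21) p.256] -/
theorem continuousOn_EkT_of_Uk (T : Transport F N) (χ : (K : ℕ) → (ℕ → ℝ) → (k : ℕ) → Density (F.P K) k (SU N)) (ε : ℝ) (K : ℕ) (g : ℕ → ℝ) (k : ℕ)
    {D : Set (GaugeField (F.P K) k (SU N))} (hA : ContinuousOn (effActionHT F N T χ K g k) D) (hU : ContinuousOn (Uk F N K k ε) D) :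
    ContinuousOn (ZeroInput.EkT F N T χ ε K g k) D :=
  continuousOn_EkT_of F N T χ ε K g k hA (continuous_wilsonAction4.comp_continuousOn hU)

/-- `𝐄_k` is measurable if `A_k` and `A^η ∘ U_k` are. [cite: Balaban1987RG1, (0.22) p.256 (bookkeeping)] -/
theorem measurable_EkT_of (T : Transport F N) (χ : (K : ℕ) → (ℕ → ℝ) → (k : ℕ) → Density (F.P K) k (SU N)) (ε : ℝ) (K : ℕ) (g : ℕ → ℝ) (k : ℕ)
    (hA : Measurable (effActionHT F N T χ K g k)) (hW : Measurable (fun V => wilsonAction4 (Uk F N K k ε V))) :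
    Measurable (ZeroInput.EkT F N T χ ε K g k) := by
  have h : ZeroInput.EkT F N T χ ε K g k = fun V => effActionHT F N T χ K g k V + (1 / (g k) ^ 2) * wilsonAction4 (Uk F N K k ε V) := rfl
  rw [h]
  exact hA.add (measurable_const.mul hW)

end Generic

/-! ## §2  At the record's chart: `x ↦ recordEkChart … B x` on the flat window -/

section Record

variable (F : T4Family)

/-- ★★ **`𝐄_k` READ IN THE CHART IS CONTINUOUS ON ANY WINDOW `S` THE CHART MAPS INTO `D`**, given the DISPLAYED continuity of `A_k` and of `A^η ∘ U_k` on `D` (✓`continuous_pert` does the rest).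
[cite: Balaban1987RG1, (2.4) p.266, (2.12)–(2.13) p.268, (0.22) p.256] -/
theorem continuousOn_recordEkChart_of (a₀ ε₂₉ : ℝ) (k : ℕ) (v : Fin (k + 1) → ℝ) (K : ℕ) (B : recordW F a₀ ε₂₉ k K)
    {S : Set (FluctIdx F k K → ℝ)} {D : Set (GaugeField (F.P K) k (SU 2))} (hSD : MapsTo (pert F k K (portVkAx F a₀ ε₂₉ k K B)) S D)
    (hA : ContinuousOn (effActionHT F 2 (TβOfRecord₁₃ F 2) (chiβOfRecord₁₃Ax F 2 (thetaFill F a₀ ε₂₉)) K (extd v) k) D)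
    (hW : ContinuousOn (fun V => wilsonAction4 (Uk F 2 K k (thetaFill F a₀ ε₂₉).εbg V)) D) :
    ContinuousOn (recordEkChart F a₀ ε₂₉ k v K B) S :=
  (continuousOn_EkT_of F 2 _ _ _ K (extd v) k hA hW).comp (continuous_pert F k K _).continuousOn hSD

/-- … hence so is print's curly bracket `recordEkBracket … B = recordEkChart … B − recordEkChart … B 0`. [cite: Balaban1987RG1, (2.12)–(2.13) p.268] -/
theorem continuousOn_recordEkBracket_of (a₀ ε₂₉ : ℝ) (k : ℕ) (v : Fin (k + 1) → ℝ) (K : ℕ) (B : recordW F a₀ ε₂₉ k K)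
    {S : Set (FluctIdx F k K → ℝ)} {D : Set (GaugeField (F.P K) k (SU 2))} (hSD : MapsTo (pert F k K (portVkAx F a₀ ε₂₉ k K B)) S D)
    (hA : ContinuousOn (effActionHT F 2 (TβOfRecord₁₃ F 2) (chiβOfRecord₁₃Ax F 2 (thetaFill F a₀ ε₂₉)) K (extd v) k) D)
    (hW : ContinuousOn (fun V => wilsonAction4 (Uk F 2 K k (thetaFill F a₀ ε₂₉).εbg V)) D) :
    ContinuousOn (recordEkBracket F a₀ ε₂₉ k v K B) S := by
  have h : recordEkBracket F a₀ ε₂₉ k v K B = fun x => recordEkChart F a₀ ε₂₉ k v K B x - recordEkChart F a₀ ε₂₉ k v K B 0 := rfl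
  rw [h]
  exact (continuousOn_recordEkChart_of F a₀ ε₂₉ k v K B hSD hA hW).sub continuousOn_const

/-- `𝐄_k` read in the chart is measurable if `A_k` and `A^η ∘ U_k` are (✓`measurable_pert`). [cite: Balaban1987RG1, (2.12) p.268 (bookkeeping)] -/
theorem measurable_recordEkChart_of (a₀ ε₂₉ : ℝ) (k : ℕ) (v : Fin (k + 1) → ℝ) (K : ℕ) (B : recordW F a₀ ε₂₉ k K)
    (hA : Measurable (effActionHT F 2 (TβOfRecord₁₃ F 2) (chiβOfRecord₁₃Ax F 2 (thetaFill F a₀ ε₂₉)) K (extd v) k))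
    (hW : Measurable (fun V => wilsonAction4 (Uk F 2 K k (thetaFill F a₀ ε₂₉).εbg V))) :
    Measurable (recordEkChart F a₀ ε₂₉ k v K B) :=
  (measurable_EkT_of F 2 _ _ _ K (extd v) k hA hW).comp (measurable_pert F k K _)

/-- ★★ **A.E.-STRONG MEASURABILITY ON A MEASURABLE WINDOW** (what a Bochner integral over the window asks of its integrand), for ANY measure on the coordinates of `B′`.
[cite: Balaban1987RG1, (2.10) p.268, (2.12)–(2.13) p.268] -/
theorem aestronglyMeasurable_recordEkChart_of (a₀ ε₂₉ : ℝ) (k : ℕ) (v : Fin (k + 1) → ℝ) (K : ℕ) (B : recordW F a₀ ε₂₉ k K)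
    {S : Set (FluctIdx F k K → ℝ)} (hS : MeasurableSet S) {D : Set (GaugeField (F.P K) k (SU 2))} (hSD : MapsTo (pert F k K (portVkAx F a₀ ε₂₉ k K B)) S D)
    (hA : ContinuousOn (effActionHT F 2 (TβOfRecord₁₃ F 2) (chiβOfRecord₁₃Ax F 2 (thetaFill F a₀ ε₂₉)) K (extd v) k) D)
    (hW : ContinuousOn (fun V => wilsonAction4 (Uk F 2 K k (thetaFill F a₀ ε₂₉).εbg V)) D) (μ : Measure (FluctIdx F k K → ℝ)) :
    AEStronglyMeasurable (recordEkChart F a₀ ε₂₉ k v K B) (μ.restrict S) :=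
  (continuousOn_recordEkChart_of F a₀ ε₂₉ k v K B hSD hA hW).aestronglyMeasurable hS

/-- The same for the curly bracket. [cite: Balaban1987RG1, (2.12)–(2.13) p.268] -/
theorem aestronglyMeasurable_recordEkBracket_of (a₀ ε₂₉ : ℝ) (k : ℕ) (v : Fin (k + 1) → ℝ) (K : ℕ) (B : recordW F a₀ ε₂₉ k K)
    {S : Set (FluctIdx F k K → ℝ)} (hS : MeasurableSet S) {D : Set (GaugeField (F.P K) k (SU 2))} (hSD : MapsTo (pert F k K (portVkAx F a₀ ε₂₉ k K B)) S D)
    (hA : ContinuousOn (effActionHT F 2 (TβOfRecord₁₃ F 2) (chiβOfRecord₁₃Ax F 2 (thetaFill F a₀ ε₂₉)) K (extd v) k) D)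
    (hW : ContinuousOn (fun V => wilsonAction4 (Uk F 2 K k (thetaFill F a₀ ε₂₉).εbg V)) D) (μ : Measure (FluctIdx F k K → ℝ)) :
    AEStronglyMeasurable (recordEkBracket F a₀ ε₂₉ k v K B) (μ.restrict S) :=
  (continuousOn_recordEkBracket_of F a₀ ε₂₉ k v K B hSD hA hW).aestronglyMeasurable hS

/-- ★★ **INTEGRABILITY ON A COMPACT WINDOW** (e.g. the closed box `|B′| ≤ …` of (2.4)∕(2.9)), for any measure finite on compacts: the curly bracket is Bochner-integrable there.
[cite: Balaban1987RG1, (2.9)–(2.10) p.268, (2.12)–(2.13) p.268] -/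
theorem integrableOn_recordEkBracket_of_isCompact (a₀ ε₂₉ : ℝ) (k : ℕ) (v : Fin (k + 1) → ℝ) (K : ℕ) (B : recordW F a₀ ε₂₉ k K)
    {S : Set (FluctIdx F k K → ℝ)} (hS : IsCompact S) {D : Set (GaugeField (F.P K) k (SU 2))} (hSD : MapsTo (pert F k K (portVkAx F a₀ ε₂₉ k K B)) S D)
    (hA : ContinuousOn (effActionHT F 2 (TβOfRecord₁₃ F 2) (chiβOfRecord₁₃Ax F 2 (thetaFill F a₀ ε₂₉)) K (extd v) k) D)
    (hW : ContinuousOn (fun V => wilsonAction4 (Uk F 2 K k (thetaFill F a₀ ε₂₉).εbg V)) D)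
    (μ : Measure (FluctIdx F k K → ℝ)) [IsFiniteMeasureOnCompacts μ] :
    IntegrableOn (recordEkBracket F a₀ ε₂₉ k v K B) S μ :=
  (continuousOn_recordEkBracket_of F a₀ ε₂₉ k v K B hSD hA hW).integrableOn_compact hS

/-- … and so is `𝐄_k` read in the chart itself. [cite: Balaban1987RG1, (2.10) p.268, (2.12) p.268] -/
theorem integrableOn_recordEkChart_of_isCompact (a₀ ε₂₉ : ℝ) (k : ℕ) (v : Fin (k + 1) → ℝ) (K : ℕ) (B : recordW F a₀ ε₂₉ k K)
    {S : Set (FluctIdx F k K → ℝ)} (hS : IsCompact S) {D : Set (GaugeField (F.P K) k (SU 2))} (hSD : MapsTo (pert F k K (portVkAx F a₀ ε₂₉ k K B)) S D)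
    (hA : ContinuousOn (effActionHT F 2 (TβOfRecord₁₃ F 2) (chiβOfRecord₁₃Ax F 2 (thetaFill F a₀ ε₂₉)) K (extd v) k) D)
    (hW : ContinuousOn (fun V => wilsonAction4 (Uk F 2 K k (thetaFill F a₀ ε₂₉).εbg V)) D)
    (μ : Measure (FluctIdx F k K → ℝ)) [IsFiniteMeasureOnCompacts μ] :
    IntegrableOn (recordEkChart F a₀ ε₂₉ k v K B) S μ :=
  (continuousOn_recordEkChart_of F a₀ ε₂₉ k v K B hSD hA hW).integrableOn_compact hS

end Record

end Summit.QuantumFields.YangMills.Theorems.BalabanUVNodesPortS1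

end
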